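import Mathlib
import HarnessLib
import Literature.MathematicalPhysics.QuantumLattice.SectorisedKernelNorm
import Literature.MathematicalPhysics.QuantumLattice.SymmetricRegimeFunctionals
import Literature.MathematicalPhysics.QuantumLattice.HubbardFermiBandCurvature
import Literature.MathematicalPhysics.QuantumLattice.AngularSectors

/-!
# Route `KLProgramme` — definitions D1 `SectorisedLegKernels`: the model-bound carriers over which the
# children of crux `KLRegimeTwoPointLimit` (stmt-HubbardSuperconductivity-19937) are stated

The route file (`Theses/KLProgramme.lean`, DEFINITION REQUESTS; DECOMP v7 §8(h) 3, App. E E1/E4 of the cell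
`gate-hubbard-kl`) asks for "D1 `SectorisedLegKernels` (model-bound: the `2n`-leg kernels of
`hubbardEffectiveActionCT L M β U μ h Λ` with their sector norms, by leg number)", over which child 1 `KLRegimeBetaSplit`
(App. E (H_j): the Cooper / non-Cooper split of the QUARTIC kernel at every scale) and child 2 `KLRegimeDispersionFlow`
(C4 (I_h): bounds on the QUADRATIC kernel) are to be typed, "with the isotropic refinement — D2 must therefore export
isotropic sector projections of the quartic kernel, not only anisotropic ones" (App. E E4).

Everything needed exists in the Literature tree EXCEPT the binding; this file is that binding and nothing else
(definitions with bodies, `rfl`-level lemmas; no analytic claim):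

* the tree's carriers, CITED: the countertermed Wilsonian effective action `hubbardEffectiveActionCT L M β U μ h K Λ`
  (`HubbardEffectiveActionCT.lean`; frame `K : TrigPolyC4v`, renormalised band `e_K = nambuXiCT L μ K`), its plain
  momentum-space kernels `GrassmannKernels.kernel`, the sectorised position-space kernels `sectorisedKernel L M β F G m`,
  the sector fields `psiSector`, the multiplier family `bgmMultiplier` (ANISOTROPIC sectors, `sectorCount n = 2^{n+1}`
  angular sectors at scale `h = -n`, BGM 2006 (2.45)–(2.48)), the constraint sets `bgmSectorSet` and the norms
  `hubbardSectorKernelNorm` / `bgmNorm` (`SectorisedKernelNorm.lean`); the momentum-space vertex functions `vertexFn`,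
  `selfEnergy`, `cooperAmplitude` (`SymmetricRegimeFunctionals.lean`); the free band curve `bandX`, `bandY`
  (`HubbardFermiBandCurvature.lean`) and the angular sectors `sectorWidth/Center/Count` (`AngularSectors.lean`);
* NEW here (the binding): `klScale e₀ n = e₀ γ^{-n}` (`γ = 4`, BGM 2006 §2.3; the infrared scale of scale index
  `h = -n`); `klEffectiveAction` — the effective action of the UNSEEDED torus (pair seed `h = 0`: the KL programme is
  the normal phase) in the frame `K` at scale `klScale e₀ n`; `klIsoMultiplier` — the ISOTROPIC sector multipliers
  (`sectorCount (2n) = 2γ^{n}` angular sectors of width `πγ^{-n}`, BGM 2006 (2.57), times the cutoff of the fields of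
  scales `≤ h`, exactly as `bgmMultiplier` with angular index `2n`); `klLegKernel … n m` — the isotropic-sectorised
  `m`-leg position-space kernels of the scale-`h` effective action and `klLegKernelNorm` — their sectorised `L¹–L^∞`
  norm on BGM's momentum-conservation constraint set; `klAnisoLegKernel(Norm)` — the same with `bgmMultiplier`;
  `klSelfEnergy`, `klCooperAmplitude` — the quadratic kernel and the on-shell Cooper array of the scale-`h` action
  (the finite-volume half of D2); and the COOPER KINEMATICS of an ordered sector 4-tuple (App. E E1): sector-centre
  momenta on the free Fermi curve `klSectorMomentum`, the particle–particle transfer `klPPTransfer`, the particle–hole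
  transfers `klPHTransferDirect/Exchange`, the sup-distance to `2πℤ²` (`torusAbs`, `torusSupNorm`) and the Cooper
  class `IsCooperClassAt` ("transfer below the resolution `γ^{-j}`").

Design.  Scales are indexed by `n : ℕ` (`h = -n ≤ 0`), as in `SectorisedKernelNorm.bgmMultiplier` and F1a
`BGM2006Sec2Setup.bgmScaleIdx`.  The carrier is the tree's Polchinski–Salmhofer effective action with the smooth cutoff
`χ₂((ω² + e_K²)/Λ²)` in a FIXED `C₄ᵥ` frame `K` (to be exhibited); BGM's `𝒱^{(h)}` with the running dispersion `E_h`
absorbed into the propagator ((2.23)) differs from it by bookkeeping (`ℒ/ℛ`), not by content — the invariants (H_j)/(I_h)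
are stated on THIS carrier (cell ruling W-004: consumers bind carriers).  Finite `(β, L, M)` throughout; nothing is
claimed about limits or bounds.  Field order of an ordered 4-tuple follows BGM 2006 (2.25):
`ψ⁺_{x₁σ} ψ⁻_{x₂σ} ψ⁺_{x₃σ'} ψ⁻_{x₄σ'}` = legs `0,1,2,3` with charges `+,-,+,-`.

References: G. Benfatto, A. Giuliani, V. Mastropietro, Ann. Henri Poincaré 7 (2006) 809–898 = arXiv:cond-mat/0507686,
§2.3 (scales, `γ = 4`), §2.5 (2.45)–(2.48), (2.57) (anisotropic / isotropic sectors), §2.7 (2.70)–(2.71), §2.8 (2.76),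
§3 (3.65)–(3.70); M. Salmhofer, Commun. Math. Phys. 194 (1998) 249, §4.1; cell gate-hubbard-kl DECOMP v7 App. E E1–E4.
-/

noncomputable section

namespace Summit.HubbardSuperconductivity.HubbardSuperconductivity.Theorems.KLProgrammeLegKernels

set_option linter.dupNamespace false -- summit = problem name (single-conjunct summit), D-0017

open Real Literature.MathematicalPhysics.QuantumLattice Literature.Probability.LatticeModels

variable (L M : ℕ) [NeZero L]

/-! ### Scales and the carrier -/

/-- **The infrared scale of scale index `h = -n`**: `Λ_h = e₀ γ^{h} = e₀ 4^{-n}` (`γ = 4`, BGM 2006 §2.3; `e₀` the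
ultraviolet end of the infrared region, BGM 2006 §2.4 item 1). [folklore] -/
def klScale (e₀ : ℝ) (n : ℕ) : ℝ := e₀ * ((4 : ℝ) ^ n)⁻¹

/-- **The scale index of the temperature** `n_β = ⌊log_γ (e₀ β / π)⌋₊`: the last scale, `γ^{h_β} e₀ ≈ π/β`
(BGM 2006 (2.38): below it the Matsubara frequencies `|k₀| ≥ π/β` leave no field to integrate). [folklore] -/
def klTempScaleIdx (β e₀ : ℝ) : ℕ := ⌊Real.logb 4 (e₀ * β / Real.pi)⌋₊

/-- **The scale-`h` effective action of the KL programme** (`h = -n`): the countertermed Wilsonian effective action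
`hubbardEffectiveActionCT L M β U μ 0 K Λ_h` of the UNSEEDED (`h_seed = 0`) Hubbard torus `hubbardTorusWith 2 L 1 U μ`
at inverse temperature `β` with `2M` Matsubara frequencies, in the `C₄ᵥ` frame `K` (renormalised band
`e_K = nambuXiCT L μ K`), at infrared scale `Λ_h = klScale e₀ n` — an element of the finite Grassmann algebra
`HubbardGrassmann L M`. [cite: BenfattoGiulianiMastropietro2006, §2.3 (2.23)] -/
def klEffectiveAction (β U μ : ℝ) (K : TrigPolyC4v) (e₀ : ℝ) (n : ℕ) : HubbardGrassmann L M :=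
  hubbardEffectiveActionCT L M β U μ 0 K (klScale e₀ n)

/-! ### Isotropic and anisotropic sector multipliers -/

/-- **The isotropic sector multipliers at scale `h = -n`** (BGM 2006 (2.57)–(2.58)):
`F̄_{h,ω̄}(k) = C_h⁻¹(|{-ik₀} + e(k⃗)|) · ζ̄_{h,ω̄}(θ(k⃗))`, `ζ̄_{h,ω̄} = sectorWeightCirc (2n) ω̄` the angular partition of
unity into `|Ō_h| = sectorCount (2n) = 2γ^{-h}` sectors of width `πγ^{h}`, `C_h⁻¹ = gnScaleCutoff 4 e₀ h` the cutoff of the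
fields of scales `≤ h`, `θ(k⃗) = momentumAngle L k⃗` — literally `bgmMultiplier` with angular index `2n` in place of `n`
(every isotropic sector sits inside one anisotropic sector). [cite: BenfattoGiulianiMastropietro2006, §2.5 (2.57)] -/
def klIsoMultiplier (e₀ β : ℝ) (e : TorusSite 2 L → ℝ) (n : ℕ) (ω : Fin (sectorCount (2 * n)))
    (k : FreqMomentum L M) : ℂ :=
  ((gnScaleCutoff 4 e₀ (-(n : ℤ)) (Real.sqrt (matsubaraFreq β M k.1 ^ 2 + e k.2 ^ 2)) *
      sectorWeightCirc (2 * n) ω (momentumAngle L k.2) : ℝ) : ℂ)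

/-- The isotropic multipliers of the KL programme in the frame `K`: band `e_K = nambuXiCT L μ K`. [folklore] -/
def klIsoFamily (β μ : ℝ) (K : TrigPolyC4v) (e₀ : ℝ) (n : ℕ) :
    Fin (sectorCount (2 * n)) → FreqMomentum L M → ℂ :=
  klIsoMultiplier L M e₀ β (nambuXiCT L μ K) n

/-- The anisotropic multipliers of the KL programme in the frame `K` (BGM 2006 (2.45)–(2.48)): the tree's
`bgmMultiplier` on the band `e_K`. [cite: BenfattoGiulianiMastropietro2006, §2.5 (2.45)–(2.48)] -/
def klAnisoFamily (β μ : ℝ) (K : TrigPolyC4v) (e₀ : ℝ) (n : ℕ) :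
    Fin (sectorCount n) → FreqMomentum L M → ℂ :=
  bgmMultiplier L M e₀ β (nambuXiCT L μ K) n

/-! ### The leg kernels and their norms -/

/-- **The isotropic-sectorised `m`-leg kernels at scale `h = -n`**: the position-space kernels
`W̄^{(h)}_{m,Ω̄}(x₁,…,x_m)` of `klEffectiveAction … n` with every leg `i` carrying the isotropic multiplier
`F̄_{h,ω̄_i}` of its label `Ω̄_i = ((ω̄_i, σ_i), c_i)` (BGM 2006 (2.70): `𝔉̄_{m,h,Ω̄} * W`) — by leg number `m`
(`m = 2`: the quadratic kernel behind C4's (I_h); `m = 4`: the quartic kernel = BGM's running coupling FUNCTION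
`λ_h(x₁,…,x₄)`, (2.25)/(3.65), the subject of C1's (H_j); `m ≥ 6`: the irrelevant kernels). [folklore] -/
def klLegKernel (β U μ : ℝ) (K : TrigPolyC4v) (e₀ : ℝ) (n m : ℕ) :
    (Fin m → SectorLeg (sectorCount (2 * n))) → (Fin m → SpaceTimeIdx L M) → ℂ :=
  sectorisedKernel L M β (klIsoFamily L M β μ K e₀ n) (klEffectiveAction L M β U μ K e₀ n) m

/-- The anisotropic-sectorised `m`-leg kernels at scale `h = -n` (BGM 2006 (2.65), (2.70)). [folklore] -/
def klAnisoLegKernel (β U μ : ℝ) (K : TrigPolyC4v) (e₀ : ℝ) (n m : ℕ) :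
    (Fin m → SectorLeg (sectorCount n)) → (Fin m → SpaceTimeIdx L M) → ℂ :=
  sectorisedKernel L M β (klAnisoFamily L M β μ K e₀ n) (klEffectiveAction L M β U μ K e₀ n) m

/-- **The sectorised `L¹–L^∞` norm of the isotropic `m`-leg kernels at scale `h = -n`** on BGM's momentum-conservation
constraint set `bgmSectorSet` (one external leg — its point and its label — fixed, the other labels summed, the other
positions integrated with `∫dx = ε_x Σ_x`; BGM 2006 (2.76), the left side of (2.71a) for `m = 4`). [folklore] -/
def klLegKernelNorm (β U μ : ℝ) (K : TrigPolyC4v) (e₀ : ℝ) (n m : ℕ) : ℝ :=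
  hubbardSectorKernelNorm L M β (klIsoFamily L M β μ K e₀ n)
    (bgmSectorSet L M (klIsoFamily L M β μ K e₀ n) m) (klEffectiveAction L M β U μ K e₀ n)

/-- The sectorised `L¹–L^∞` norm of the anisotropic `m`-leg kernels at scale `h = -n` (BGM 2006 (2.76)). [folklore] -/
def klAnisoLegKernelNorm (β U μ : ℝ) (K : TrigPolyC4v) (e₀ : ℝ) (n m : ℕ) : ℝ :=
  hubbardSectorKernelNorm L M β (klAnisoFamily L M β μ K e₀ n)
    (bgmSectorSet L M (klAnisoFamily L M β μ K e₀ n) m) (klEffectiveAction L M β U μ K e₀ n)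

/-- BGM's full scale-weighted norm `‖·‖_{h,ρ}` of the scale-`h` action in the frame `K` (the tree's `bgmNorm` on the
band `e_K`; BGM 2006 (2.77)). [folklore] -/
def klBGMNorm (β U μ : ℝ) (K : TrigPolyC4v) (e₀ : ℝ) (n : ℕ) (ρ : ℝ) : ℝ :=
  bgmNorm L M e₀ β (nambuXiCT L μ K) n ρ (klEffectiveAction L M β U μ K e₀ n)

/-! ### Momentum-space functionals of the scale-`h` action (finite-volume half of D2) -/

/-- **The self-energy of the scale-`h` action** `Σ_h(K, σ) = 𝒱₂(ψ̂⁺_{Kσ}, ψ̂⁻_{Kσ})` (the tree's `selfEnergy`; the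
dressed inverse propagator is `-iω + e_K + Σ_h`): the object of C4's dispersion flow (I_h). [folklore] -/
def klSelfEnergy (β U μ : ℝ) (K : TrigPolyC4v) (e₀ : ℝ) (n : ℕ) (k : FreqMomentum L M) (σ : Fin 2) : ℂ :=
  selfEnergy L M β (klEffectiveAction L M β U μ K e₀ n) k σ

/-- **The on-shell Cooper array of the scale-`h` action**: `𝒞_h(k⃗, k⃗') = 𝒱₄(ψ̂⁺_{(ω₀,k⃗')↑} ψ̂⁺_{(-ω₀,-k⃗')↓}
ψ̂⁻_{(-ω₀,-k⃗)↓} ψ̂⁻_{(ω₀,k⃗)↑})`, the pair `(k⃗↑, -k⃗↓) → (k⃗'↑, -k⃗'↓)` at the lowest Matsubara frequencies (the tree's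
`cooperAmplitude`; bare value `+U`): the finite-volume kernel whose `D₄` blocks on the Fermi curve are D2's
`cooperVertexBlock`, and whose sector averages are App. E E1's array `V_h(q = 0; θ̄_out, θ̄_in)`. [folklore] -/
def klCooperAmplitude [NeZero M] (β U μ : ℝ) (K : TrigPolyC4v) (e₀ : ℝ) (n : ℕ) (k k' : TorusSite 2 L) : ℂ :=
  cooperAmplitude L M β (klEffectiveAction L M β U μ K e₀ n) k k'

/-! ### Cooper kinematics of ordered isotropic sector 4-tuples (App. E E1) -/

/-- The distance from a real number to `2πℤ`: `|x|_𝕋 = |x mod 2π|` with the representative in `(-π, π]`. [folklore] -/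
def torusAbs (x : ℝ) : ℝ := |toIocMod Real.two_pi_pos (-Real.pi) x|

/-- The sup-distance from `w ∈ ℝ²` to the reciprocal lattice `2πℤ²`: `|w|_𝕋 = max (|w₁|_𝕋) (|w₂|_𝕋)` (the form in which
the `KLProgrammeKLRegimeTwoPointLimitShell*` files quantify "for all `m₀ m₁ : ℤ`"). [folklore] -/
def torusSupNorm (w : ℝ × ℝ) : ℝ := max (torusAbs w.1) (torusAbs w.2)

/-- **The sector-centre momentum on the free Fermi curve** of the isotropic sector `ω̄` at scale `h = -n`:
`p̄(ω̄) = p_F(θ̄_ω̄) = (bandX μ θ̄, bandY μ θ̄)`, `θ̄ = sectorCenter (2n) ω̄ = (ω̄ + ½) πγ^{-n}` (App. E E1: transfer momenta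
are read at the sector centres, "each defined up to `O(γ^{h})`"). [folklore] -/
def klSectorMomentum (μ : ℝ) (n : ℕ) (ω : Fin (sectorCount (2 * n))) : ℝ × ℝ :=
  (bandX μ (sectorCenter (2 * n) ω), bandY μ (sectorCenter (2 * n) ω))

/-- An ordered label 4-tuple is in **BGM field order** (BGM 2006 (2.25)): charges `(+,-,+,-)` and spins
`(σ, σ, σ', σ')`. [folklore] -/
def IsBGMOrdered {N : ℕ} (Ω : Fin 4 → SectorLeg N) : Prop :=
  (Ω 0).2 = 0 ∧ (Ω 1).2 = 1 ∧ (Ω 2).2 = 0 ∧ (Ω 3).2 = 1 ∧ (Ω 0).1.2 = (Ω 1).1.2 ∧ (Ω 2).1.2 = (Ω 3).1.2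

/-- **The particle–particle transfer** of an ordered isotropic 4-tuple at scale `h = -n`:
`q(Ω̄) = p̄(ω̄₂) + p̄(ω̄₄)` — the total momentum of the two annihilated legs (`1`, `3` in `Fin 4`), in `ℝ²`; read modulo
`2πℤ²` through `torusSupNorm` (App. E E1; `≡ p̄(ω̄₁) + p̄(ω̄₃)` up to `O(γ^{h})` on the constraint set). [folklore] -/
def klPPTransfer (μ : ℝ) (n : ℕ) (Ω : Fin 4 → SectorLeg (sectorCount (2 * n))) : ℝ × ℝ :=
  klSectorMomentum μ n (Ω 1).1.1 + klSectorMomentum μ n (Ω 3).1.1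

/-- **The direct particle–hole transfer** `Q_d(Ω̄) = p̄(ω̄₁) - p̄(ω̄₂)` (legs `0`, `1`: same spin). [folklore] -/
def klPHTransferDirect (μ : ℝ) (n : ℕ) (Ω : Fin 4 → SectorLeg (sectorCount (2 * n))) : ℝ × ℝ :=
  klSectorMomentum μ n (Ω 0).1.1 - klSectorMomentum μ n (Ω 1).1.1

/-- **The exchange particle–hole transfer** `Q_x(Ω̄) = p̄(ω̄₁) - p̄(ω̄₄)` (legs `0`, `3`). [folklore] -/
def klPHTransferExchange (μ : ℝ) (n : ℕ) (Ω : Fin 4 → SectorLeg (sectorCount (2 * n))) : ℝ × ℝ :=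
  klSectorMomentum μ n (Ω 0).1.1 - klSectorMomentum μ n (Ω 3).1.1

/-- **The Cooper class at resolution `j`** (App. E E1: "transfer below the resolution"): the particle–particle
transfer of the ordered isotropic 4-tuple at scale `h = -n` lies within `γ^{-j} = 4^{-j}` of `2πℤ²` (umklapp Cooper
pairs `k₂ + k₄ ∈ 2πℤ² ∖ {0}` included: `-k ≡ G - k` on the torus). [folklore] -/
def IsCooperClassAt (μ : ℝ) (n j : ℕ) (Ω : Fin 4 → SectorLeg (sectorCount (2 * n))) : Prop :=
  torusSupNorm (klPPTransfer μ n Ω) ≤ ((4 : ℝ) ^ j)⁻¹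

/-! ### Bookkeeping lemmas (`rfl`-level) -/

omit [NeZero L] in
/-- The isotropic multipliers ARE the tree's `bgmMultiplier` formula at angular index `2n`. [folklore] -/
theorem klIsoMultiplier_eq (e₀ β : ℝ) (e : TorusSite 2 L → ℝ) (n : ℕ) (ω : Fin (sectorCount (2 * n)))
    (k : FreqMomentum L M) :
    klIsoMultiplier L M e₀ β e n ω k =
      ((gnScaleCutoff 4 e₀ (-(n : ℤ)) (Real.sqrt (matsubaraFreq β M k.1 ^ 2 + e k.2 ^ 2)) *
        sectorWeightCirc (2 * n) ω (momentumAngle L k.2) : ℝ) : ℂ) := rfl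

omit [NeZero L] in
/-- `|F̄_{h,ω̄}(k)| ≤ 1`. [folklore] -/
theorem norm_klIsoMultiplier_le_one (e₀ β : ℝ) (e : TorusSite 2 L → ℝ) (n : ℕ) (ω : Fin (sectorCount (2 * n)))
    (k : FreqMomentum L M) : ‖klIsoMultiplier L M e₀ β e n ω k‖ ≤ 1 := by
  rw [klIsoMultiplier, Complex.norm_real, Real.norm_eq_abs,
    abs_of_nonneg (mul_nonneg (gnScaleCutoff_mem_Icc _ _ _ _).1 (sectorWeightCirc_nonneg _ _ _))]
  exact mul_le_one₀ (gnScaleCutoff_mem_Icc _ _ _ _).2 (sectorWeightCirc_nonneg _ _ _) (sectorWeightCirc_le_one _ _ _)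

omit [NeZero L] in
/-- **The isotropic multipliers sum to the cutoff of the fields of scales `≤ h`** — the same total as the anisotropic
ones (`sum_bgmMultiplier`): `Σ_{ω̄ ∈ Ō_h} F̄_{h,ω̄}(k) = C_h⁻¹(|{-ik₀} + e(k⃗)|) = Σ_{ω ∈ O_h} F_{h,ω}(k)` (the isotropic partition
refines the anisotropic one, BGM 2006 (2.57)). [cite: BenfattoGiulianiMastropietro2006, §2.5 (2.57)] -/
theorem sum_klIsoMultiplier (e₀ β : ℝ) (e : TorusSite 2 L → ℝ) (n : ℕ) (k : FreqMomentum L M) :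
    ∑ ω : Fin (sectorCount (2 * n)), klIsoMultiplier L M e₀ β e n ω k =
      ∑ ω : Fin (sectorCount n), bgmMultiplier L M e₀ β e n ω k := by
  rw [sum_bgmMultiplier]
  simp only [klIsoMultiplier, Complex.ofReal_mul, ← Finset.mul_sum]
  rw [← Complex.ofReal_sum,
    Fin.sum_univ_eq_sum_range (fun i => sectorWeightCirc (2 * n) (i : ℤ) (momentumAngle L k.2)),
    show (∑ i ∈ Finset.range (sectorCount (2 * n)), sectorWeightCirc (2 * n) ((i : ℕ) : ℤ) (momentumAngle L k.2)) = 1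
      from sum_sectorWeightCirc_eq_one (2 * n) _, Complex.ofReal_one, mul_one]

/-- The leg kernels are the tree's `sectorisedKernel` of the scale-`h` action (unfolding lemma for consumers). [folklore] -/
theorem klLegKernel_eq (β U μ : ℝ) (K : TrigPolyC4v) (e₀ : ℝ) (n m : ℕ) :
    klLegKernel L M β U μ K e₀ n m =
      sectorisedKernel L M β (klIsoFamily L M β μ K e₀ n) (klEffectiveAction L M β U μ K e₀ n) m := rfl

/-- In the BARE frame `K = 0` the carrier is the tree's seedless effective action `hubbardEffectiveAction … 0 Λ_h`. [folklore] -/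
theorem klEffectiveAction_zero_frame (β U μ e₀ : ℝ) (n : ℕ) :
    klEffectiveAction L M β U μ 0 e₀ n = hubbardEffectiveAction L M β U μ 0 (klScale e₀ n) := by
  rw [klEffectiveAction, hubbardEffectiveActionCT_zero_frame]

/-- The leg-kernel norm is non-negative (for `β ≥ 0`). [folklore] -/
theorem klLegKernelNorm_nonneg {β : ℝ} (hβ : 0 ≤ β) (U μ : ℝ) (K : TrigPolyC4v) (e₀ : ℝ) (n m : ℕ) :
    0 ≤ klLegKernelNorm L M β U μ K e₀ n m :=
  hubbardSectorKernelNorm_nonneg hβ _ _ _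

/-- `|x|_𝕋 ≤ π`. [folklore] -/
theorem torusAbs_le_pi (x : ℝ) : torusAbs x ≤ Real.pi := by
  unfold torusAbs
  have h₁ := left_lt_toIocMod Real.two_pi_pos (-Real.pi) x
  have h₂ := toIocMod_le_right Real.two_pi_pos (-Real.pi) x
  rw [abs_le]
  constructor <;> linarith

/-- `0 ≤ |w|_𝕋`. [folklore] -/
theorem torusSupNorm_nonneg (w : ℝ × ℝ) : 0 ≤ torusSupNorm w :=
  le_max_of_le_left (abs_nonneg _)

/-- `|x|_𝕋 ≤ |x - 2πm|` for every integer `m` (the torus distance is the least distance to a lattice point). [folklore] -/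
theorem torusAbs_le (x : ℝ) (m : ℤ) : torusAbs x ≤ |x - m * (2 * Real.pi)| := by
  unfold torusAbs
  set y := toIocMod Real.two_pi_pos (-Real.pi) x with hy
  obtain ⟨z, hz⟩ : ∃ z : ℤ, x - m * (2 * Real.pi) = y + z * (2 * Real.pi) := by
    refine ⟨toIocDiv Real.two_pi_pos (-Real.pi) x - m, ?_⟩
    have := (toIocMod_add_toIocDiv_zsmul Real.two_pi_pos (-Real.pi) x)
    rw [zsmul_eq_mul] at this
    push_cast
    linarith
  rw [hz]
  have h₁ := left_lt_toIocMod Real.two_pi_pos (-Real.pi) x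
  have h₂ := toIocMod_le_right Real.two_pi_pos (-Real.pi) x
  rw [← hy] at h₁ h₂
  rcases lt_trichotomy z 0 with hz0 | hz0 | hz0
  · have hz1 : (z : ℝ) ≤ -1 := by exact_mod_cast Int.le_sub_one_of_lt hz0
    rw [abs_le] ; constructor <;> nlinarith [abs_le.mp (le_refl |y|), abs_nonneg y, Real.pi_pos, le_abs_self y, neg_abs_le y,
      abs_of_nonpos (show y + z * (2 * Real.pi) ≤ 0 by nlinarith [Real.pi_pos])]
  · subst hz0; simp
  · have hz1 : (1 : ℝ) ≤ z := by exact_mod_cast hz0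
    rw [abs_of_nonneg (show (0:ℝ) ≤ y + z * (2 * Real.pi) by nlinarith [Real.pi_pos])]
    rw [abs_le]; constructor <;> nlinarith [Real.pi_pos]

end Summit.HubbardSuperconductivity.HubbardSuperconductivity.Theorems.KLProgrammeLegKernels

end
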